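import Summits.NavierStokesRegularity.NavierStokesRegularity.Theses.GaldiLiouvilleGate
import Summits.NavierStokesRegularity.NavierStokesRegularity.Theorems.GaldiLiouvilleGateAllAxesCylinderRay
import HarnessLib

/-!
# All-axes cylinder budget, piece O1a″ (3/3): `CylinderDecayOfHessian`

Obligation O1a″ of the «all-axes cylinder budget» line for `GaldiLiouvilleGate.GaldiLiouville`
(stmt-NavierStokesRegularity-0895), Defs of record `pub/ideators/ns-idea-4/lines/combined/
CylinderBudgets_v3_1.lean` (sha16 817120c4c833a18a):

  `CylinderDecayOfHessian : PressureHessianIntegrable → HeadMaximumPrinciple → PressureCylinderDecay`,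

stated here with the three v3.1 bodies UNFOLDED verbatim (arbiter ruling ns-in-ser-a g2 11:16:35Z (2)(b):
no Defs import, no new `def`; the re-bundling Defs file applies this theorem by `exact`).
Content: `∇²P ∈ L¹(ℝ³)` and `P → c` at infinity give (i) `∫_{r<R}|P − c| ≤ (R²/2)‖∇²P‖₁ < ∞` and
(ii) `R⁻²∫_{R<r<2R}|P − c| ≤ (3/2)‖∇²P‖_{L¹(r>R)} → 0` (`r` = distance to the `x₃`-axis), by the
ray inequality of pieces 1/3–2/3 (Wang 2025, proof of Lemma 3.5, p. 50: «`∂_r p ∈ L¹(P₊)`,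
`∫ p(t,z)dz = −∫_t^∞∫∂_r p → 0`»). Of `HeadMaximumPrinciple` only the limit `P → c` is used.

Theorems only, standard axioms, no `sorry`.

WHAT THIS IS NOT: not a proof of ⟨0895⟩/⟨0896⟩ nor of any NS regularity statement; O1c′
(`CylinderBookkeepingSplit`) and the rung assemblies remain with their owners.
-/

set_option linter.dupNamespace false

noncomputable section

open MeasureTheory Set Filter Topology
open scoped ENNReal Topology
open Literature.Analysis.FluidPDE

namespace Summit.NavierStokesRegularity.NavierStokesRegularity.Theorems.GaldiLiouville.AllAxesBudget

/-- Tails over the shrinking axis-exteriors `{r > R}` of a finite integral vanish (continuity from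
above of the finite measure `volume.withDensity g`). [folklore] -/
theorem tendsto_setLIntegral_cylRadius_gt_atTop {g : EuclideanSpace ℝ (Fin 3) → ℝ≥0∞}
    (hfin : ∫⁻ x, g x < ⊤) :
    Tendsto (fun R : ℝ => ∫⁻ x in {x : EuclideanSpace ℝ (Fin 3) | R < cylRadius x}, g x)
      atTop (𝓝 0) := by
  -- adapted from the line's O3 proof (`swirlEnergyTailVanish_proof`, CylinderBudgets_v3_1.lean)
  have hmeas : ∀ t : ℝ, MeasurableSet {x : EuclideanSpace ℝ (Fin 3) | t < cylRadius x} := fun t =>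
    measurableSet_lt measurable_const continuous_cylRadius.measurable
  have hrew : ∀ t : ℝ, (∫⁻ x in {x : EuclideanSpace ℝ (Fin 3) | t < cylRadius x}, g x) =
      (volume.withDensity g) {x : EuclideanSpace ℝ (Fin 3) | t < cylRadius x} :=
    fun t => (withDensity_apply _ (hmeas t)).symm
  simp_rw [hrew]
  have hanti : Antitone (fun t : ℝ => {x : EuclideanSpace ℝ (Fin 3) | t < cylRadius x}) :=
    fun a b hab x (hx : b < cylRadius x) => lt_of_le_of_lt hab hx
  have hfin' : ∃ t : ℝ, (volume.withDensity g) {x : EuclideanSpace ℝ (Fin 3) | t < cylRadius x} ≠ ⊤ :=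
    ⟨0, by
      refine ne_top_of_le_ne_top hfin.ne ?_
      rw [← hrew]
      exact setLIntegral_le_lintegral _ _⟩
  have hinter : (⋂ t : ℝ, {x : EuclideanSpace ℝ (Fin 3) | t < cylRadius x}) = ∅ := by
    ext x
    simp only [mem_iInter, mem_setOf_eq, mem_empty_iff_false, iff_false, not_forall, not_lt]
    exact ⟨cylRadius x, le_rfl⟩
  have h := tendsto_measure_iInter_atTop (μ := volume.withDensity g)
    (fun t => (hmeas t).nullMeasurableSet) hanti hfin'
  rw [hinter, measure_empty] at h
  exact h

/-- **O1a″ `CylinderDecayOfHessian`** (v3.1 817120c4c833a18a, bodies of `PressureHessianIntegrable`,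
`HeadMaximumPrinciple`, `PressureCylinderDecay`, `IsDSolution` unfolded verbatim): for smooth steady
D-solutions, `∇²P ∈ L¹(ℝ³)` and the pressure limit `P → c` (taken from the head maximum principle
package) give solid-cylinder integrability of `|P − c|` and the shell decay `R⁻²∫_{R<r<2R}|P − c| → 0`.
[cite: Wang2025, Lemma 3.5 (proof, p. 50)] -/
theorem cylinderDecayOfHessian :
    (∀ ν : ℝ, 0 < ν → ∀ (U : EuclideanSpace ℝ (Fin 3) → EuclideanSpace ℝ (Fin 3))
        (P : EuclideanSpace ℝ (Fin 3) → ℝ),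
        (IsLerayProfile ν 0 U P ∧ ContDiff ℝ (⊤ : ℕ∞) U ∧ ContDiff ℝ (⊤ : ℕ∞) P ∧
          (∫⁻ y, ENNReal.ofReal (frobeniusNormSq (fderiv ℝ U y))) < ⊤ ∧
          Tendsto U (cocompact (EuclideanSpace ℝ (Fin 3))) (𝓝 0)) →
        Integrable (iteratedFDeriv ℝ 2 P)) →
    (∀ ν : ℝ, 0 < ν → ∀ (U : EuclideanSpace ℝ (Fin 3) → EuclideanSpace ℝ (Fin 3))
        (P : EuclideanSpace ℝ (Fin 3) → ℝ),
        (IsLerayProfile ν 0 U P ∧ ContDiff ℝ (⊤ : ℕ∞) U ∧ ContDiff ℝ (⊤ : ℕ∞) P ∧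
          (∫⁻ y, ENNReal.ofReal (frobeniusNormSq (fderiv ℝ U y))) < ⊤ ∧
          Tendsto U (cocompact (EuclideanSpace ℝ (Fin 3))) (𝓝 0)) →
        ∃ c : ℝ, Tendsto P (cocompact (EuclideanSpace ℝ (Fin 3))) (𝓝 c) ∧
          ∀ x, P x + ‖U x‖ ^ 2 / 2 ≤ c) →
    ∀ ν : ℝ, 0 < ν → ∀ (U : EuclideanSpace ℝ (Fin 3) → EuclideanSpace ℝ (Fin 3))
        (P : EuclideanSpace ℝ (Fin 3) → ℝ),
        (IsLerayProfile ν 0 U P ∧ ContDiff ℝ (⊤ : ℕ∞) U ∧ ContDiff ℝ (⊤ : ℕ∞) P ∧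
          (∫⁻ y, ENNReal.ofReal (frobeniusNormSq (fderiv ℝ U y))) < ⊤ ∧
          Tendsto U (cocompact (EuclideanSpace ℝ (Fin 3))) (𝓝 0)) →
        ∃ c : ℝ, Tendsto P (cocompact (EuclideanSpace ℝ (Fin 3))) (𝓝 c) ∧
          (∀ R : ℝ, (∫⁻ x in {x | cylRadius x < R}, ENNReal.ofReal |P x - c|) < ⊤) ∧
          Tendsto (fun R : ℝ => ENNReal.ofReal (R⁻¹ ^ 2) *
            ∫⁻ x in {x | R < cylRadius x ∧ cylRadius x < 2 * R}, ENNReal.ofReal |P x - c|)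
            atTop (𝓝 0) := by
  intro hHess hHead ν hν U P hD
  obtain ⟨c, hPc, -⟩ := hHead ν hν U P hD
  have hI : Integrable (iteratedFDeriv ℝ 2 P) := hHess ν hν U P hD
  have hP2 : ContDiff ℝ 2 P := hD.2.2.1.of_le (by norm_cast)
  have hfin : ∫⁻ x, ENNReal.ofReal ‖iteratedFDeriv ℝ 2 P x‖ < ⊤ := by
    have h := hI.hasFiniteIntegral
    rw [hasFiniteIntegral_iff_enorm] at h
    simpa only [ofReal_norm] using h
  refine ⟨c, hPc, fun R => ?_, ?_⟩
  · -- (i) solid cylinders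
    by_cases hR : 0 ≤ R
    · exact (solid_lintegral_abs_sub_le hP2 hPc hR).trans_lt (ENNReal.mul_lt_top ENNReal.ofReal_lt_top hfin)
    · have hempty : {x : EuclideanSpace ℝ (Fin 3) | cylRadius x < R} = ∅ :=
        eq_empty_iff_forall_notMem.2 fun x hx => hR ((cylRadius_nonneg x).trans (le_of_lt hx))
      rw [hempty, Measure.restrict_empty, lintegral_zero_measure]
      exact ENNReal.zero_lt_top
  · -- (ii) shells: squeeze between `0` and `(3/2) ∫_{r > R} ‖D²P‖ → 0`
    have hT := tendsto_setLIntegral_cylRadius_gt_atTop hfin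
    have hT' : Tendsto (fun R : ℝ => ENNReal.ofReal (3 / 2) *
        ∫⁻ x in {x : EuclideanSpace ℝ (Fin 3) | R < cylRadius x}, ENNReal.ofReal ‖iteratedFDeriv ℝ 2 P x‖)
        atTop (𝓝 0) := by
      have h := ENNReal.Tendsto.const_mul hT (Or.inr ENNReal.ofReal_ne_top) (a := ENNReal.ofReal (3 / 2))
      rwa [mul_zero] at h
    refine tendsto_of_tendsto_of_tendsto_of_le_of_le' tendsto_const_nhds hT'
      (Eventually.of_forall fun _ => zero_le) ?_
    filter_upwards [eventually_gt_atTop (0 : ℝ)] with R hR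
    calc ENNReal.ofReal (R⁻¹ ^ 2) *
          ∫⁻ x in {x | R < cylRadius x ∧ cylRadius x < 2 * R}, ENNReal.ofReal |P x - c|
        ≤ ENNReal.ofReal (R⁻¹ ^ 2) * (ENNReal.ofReal (3 * R ^ 2 / 2) *
          ∫⁻ x in {x : EuclideanSpace ℝ (Fin 3) | R < cylRadius x},
            ENNReal.ofReal ‖iteratedFDeriv ℝ 2 P x‖) :=
          mul_le_mul' le_rfl (shell_lintegral_abs_sub_le hP2 hPc hR)
      _ = ENNReal.ofReal (3 / 2) *
          ∫⁻ x in {x : EuclideanSpace ℝ (Fin 3) | R < cylRadius x},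
            ENNReal.ofReal ‖iteratedFDeriv ℝ 2 P x‖ := by
          rw [← mul_assoc, ← ENNReal.ofReal_mul (by positivity)]
          congr 2
          field_simp


/-- **The analytic lemma behind O1a″, standalone** (arbiter request ns-in-ser-a g2 11:45:36Z (1)):
for `P ∈ C²(ℝ³)` with `∇²P ∈ L¹(ℝ³)` and `P → c` at infinity,
(i) `∫_{r<R} |P − c| dx < ∞` for every `R`, and (ii) `R⁻² ∫_{R<r<2R} |P − c| dx → 0` as `R → ∞`
(`r = cylRadius`, the distance to the `x₃`-axis). No fluid structure is involved.
[cite: Wang2025, Lemma 3.5 (proof, p. 50)] -/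
theorem pressureCylinderDecay_of_integrable_hessian {P : EuclideanSpace ℝ (Fin 3) → ℝ} {c : ℝ}
    (hP2 : ContDiff ℝ 2 P) (hI : Integrable (iteratedFDeriv ℝ 2 P))
    (hPc : Tendsto P (cocompact (EuclideanSpace ℝ (Fin 3))) (𝓝 c)) :
    (∀ R : ℝ, (∫⁻ x in {x | cylRadius x < R}, ENNReal.ofReal |P x - c|) < ⊤) ∧
      Tendsto (fun R : ℝ => ENNReal.ofReal (R⁻¹ ^ 2) *
        ∫⁻ x in {x | R < cylRadius x ∧ cylRadius x < 2 * R}, ENNReal.ofReal |P x - c|)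
        atTop (𝓝 0) := by
  have hfin : ∫⁻ x, ENNReal.ofReal ‖iteratedFDeriv ℝ 2 P x‖ < ⊤ := by
    have h := hI.hasFiniteIntegral
    rw [hasFiniteIntegral_iff_enorm] at h
    simpa only [ofReal_norm] using h
  refine ⟨fun R => ?_, ?_⟩
  · by_cases hR : 0 ≤ R
    · exact (solid_lintegral_abs_sub_le hP2 hPc hR).trans_lt (ENNReal.mul_lt_top ENNReal.ofReal_lt_top hfin)
    · have hempty : {x : EuclideanSpace ℝ (Fin 3) | cylRadius x < R} = ∅ :=
        eq_empty_iff_forall_notMem.2 fun x hx => hR ((cylRadius_nonneg x).trans (le_of_lt hx))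
      rw [hempty, Measure.restrict_empty, lintegral_zero_measure]
      exact ENNReal.zero_lt_top
  · have hT := tendsto_setLIntegral_cylRadius_gt_atTop hfin
    have hT' : Tendsto (fun R : ℝ => ENNReal.ofReal (3 / 2) *
        ∫⁻ x in {x : EuclideanSpace ℝ (Fin 3) | R < cylRadius x}, ENNReal.ofReal ‖iteratedFDeriv ℝ 2 P x‖)
        atTop (𝓝 0) := by
      have h := ENNReal.Tendsto.const_mul hT (Or.inr ENNReal.ofReal_ne_top) (a := ENNReal.ofReal (3 / 2))
      rwa [mul_zero] at h
    refine tendsto_of_tendsto_of_tendsto_of_le_of_le' tendsto_const_nhds hT'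
      (Eventually.of_forall fun _ => zero_le) ?_
    filter_upwards [eventually_gt_atTop (0 : ℝ)] with R hR
    calc ENNReal.ofReal (R⁻¹ ^ 2) *
          ∫⁻ x in {x | R < cylRadius x ∧ cylRadius x < 2 * R}, ENNReal.ofReal |P x - c|
        ≤ ENNReal.ofReal (R⁻¹ ^ 2) * (ENNReal.ofReal (3 * R ^ 2 / 2) *
          ∫⁻ x in {x : EuclideanSpace ℝ (Fin 3) | R < cylRadius x},
            ENNReal.ofReal ‖iteratedFDeriv ℝ 2 P x‖) :=
          mul_le_mul' le_rfl (shell_lintegral_abs_sub_le hP2 hPc hR)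
      _ = ENNReal.ofReal (3 / 2) *
          ∫⁻ x in {x : EuclideanSpace ℝ (Fin 3) | R < cylRadius x},
            ENNReal.ofReal ‖iteratedFDeriv ℝ 2 P x‖ := by
          rw [← mul_assoc, ← ENNReal.ofReal_mul (by positivity)]
          congr 2
          field_simp

end Summit.NavierStokesRegularity.NavierStokesRegularity.Theorems.GaldiLiouville.AllAxesBudget

end
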